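import Summits.BirchSwinnertonDyer.BirchSwinnertonDyer.Theorems.ErratumRoadFiveIMCDivOneSidedCongruenceLe
import Summits.BirchSwinnertonDyer.BirchSwinnertonDyer.Theorems.ErratumRoadFiveIMCDivOneSidedCongruenceTorsionDefs
import HarnessLib

/-!
# Route `ErratumRoadFive`, crux `IMCDivAtErratumDataAll` (item stmt-BirchSwinnertonDyer-19270), stub S2
# `stub_imcDivErratum_splitAtP`: the one-sided congruence package with (c) AND the `Σ`-identity
# ONE-SIDED — shapes and the glue to the crux and to both registered stubs

Cell `bsd-stepL` (run/shared/lean/pub/bsd-stepL/), PART 1b ACCEL seat `bsd-stepL-imc24b` (prover, row (2),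
session g3); `--supports stmt-BirchSwinnertonDyer-19270 --as helper`; the packaging of
`Theorems/ErratumRoadFiveIMCDivOneSidedCongruenceLe.lean` (the one-sided-(c) transfer on `X_ac`) in the
currency of imc24c's `Theorems/ErratumRoadFiveIMCDivOneSidedCongruenceTorsionDefs.lean`. HONEST FRAMING:
nothing is asserted about any curve; the item is NOT closed; BSD is proved for no pair; two
`Prop`-valued SHAPES (claim-tagged, assert nothing) and theorems; no named fact; no `sorry`.

## Why (S2 = split multiplicative `p`)

imc24c's torsion-only package `P2.OneSidedCongruenceDataTorsionAt` carries the congruence input (c) as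
the EQUALITY `(L_m) + (p)^m = (L^Σ) + (p)^m` and the `Σ`-identity as the EQUALITY `(L^Σ) = (L·P_Σ)`.
At the `p`-NEW weight-2 point the equality-(c) with `L := ` the Cas18-Thm-3.1 frame is what print
delivers ([Cas18, (4.1)] + p. 11 L9–11 «the proof of [Cas20, Thm. 2.11] shows») only under the `p`-new
identification of the two-variable function's specialisation; read with the PRINTED (`p`-old)
multiplier of [Cas20, Thm. 2.11] the two differ by the square of the seam `1 − a_p^{-1}σ_𝔭̄`, a unit at
`a_p = −1` and a non-unit in `(T)` at `a_p = +1` (companion `Theorems/ErratumRoadFiveIMCDivPNewSeam.lean`).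
The descent reads only `(L_m) ⊆ (L^Σ) + (p)^m` and `L·P_Σ ∣ L^Σ`, available in either reading. THIS
FILE packages exactly those one-sided inputs, shows imc24c's package implies it conjunct by conjunct,
and derives the crux shape and BOTH registered stub signatures from it — so the S2 instance of Road FF
closes by name from a package whose (c) needs no `p`-new identification beyond
`L^Σ_f ∣ ν_f(L^Σ_p(𝐟))`.

## What this file proves

* §1 shape **`P2.OneSidedCongruenceDataLeAt W p κ 𝔭 γ ι f`** = `P2.OneSidedCongruenceDataTorsionAt` with
  (c) replaced by `(L_m) ⊆ (L^Σ) + (p)^m` and `(L^Σ) = (L·P_Σ)` by `L·P_Σ ∣ L^Σ`;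
  `P2.oneSidedCongruenceDataLeAt_of_torsionAt` (imc24c's package ⟹ this one);
  `P2.exists_unrFrame_charIdeal_map_le_of_oneSidedCongruenceDataLeAt` (⟹ `R₀`-frame with
  `Ch_Λ(X_ac^∅)·R₀⟦T⟧ ⊆ (L)`, by `AcSelmer.XAc.charIdeal_map_toUnr_le_span_of_oneSided_congruences_le`);
  `P2.exists_intCoreFrame_of_oneSidedCongruenceDataLeAt` (⟹ the crux's ♭-frame conjunct).
* §2 shape **`P2.OneSidedCongruenceDataLeAtErratumData W p`** (crux binders VERBATIM),
  `P2.oneSidedCongruenceDataLeAtErratumData_of_torsion`, the glue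
  **`P2.imcDivIntCoreFrameAtErratumData_of_oneSidedCongruenceDataLe`** and both REGISTERED stub
  signatures of crux 19270 as corollaries
  (`P2.stub_imcDivErratum_{nonsplitAtP,splitAtP}_of_oneSidedCongruenceDataLe`) — ONE sign-blind proof.

NET: on the one-sided road the typed package per erratum datum is {frame [Cas18 Thm. 3.1], `Σ` finite,
`X^Σ` torsion [CTL], members with (b)+Lemma 2.1 [objects D1 ∕ D2], (2.5)_m [FW21 Thm. 4.41 — the ONE
PREPRINT brick], (c)♭ `(L_m) ⊆ (L^Σ) + (p)^m` [Cas18 (4.1) + family congruence, either reading of Cas20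
Thm. 2.11 at the `p`-new point], one-sided `Σ`-data [GV00 2.4 ∕ Cas18 (3.1), injective half]}.

References: [Castella2018Erratum] (a)–(c), Lemma 2.1, (2.5), proof of Thm. 1.1 (pp. 2–4);
[Skinner2016PacificMC] §3.1; [Castella2018] Def. 2.2, (3.1), Thm. 3.1, (4.1), p. 11; [Castella2020JIMJ]
Thm. 2.11; [FouquetWan2021] Thm. 4.41 (PREPRINT).
-/

set_option autoImplicit false

noncomputable section

open scoped Classical

open WeierstrassCurve NumberField IsDedekindDomain Field PowerSeries
open Literature.NumberTheory.EllipticCurves Literature.NumberTheory.EllipticCurves.GreenbergSelmer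
  Literature.NumberTheory.EllipticCurves.ModularForms Literature.NumberTheory.EllipticCurves.Rank1Residual
  Literature.NumberTheory.EllipticCurves.Rank1Residual.Typed Literature.NumberTheory.EllipticCurves.Castella2018
  Literature.NumberTheory.EllipticCurves.Module Literature.NumberTheory.GaloisRepresentations
  Literature.NumberTheory.GaloisCohomology Literature.RingTheory.FittingIdeal
open Summit.BirchSwinnertonDyer.Rank1Residual.X11b.AcSelmer Summit.BirchSwinnertonDyer.Rank1Residual.X11b.Halves

namespace Summit.BirchSwinnertonDyer.Rank1Residual.X11b

/-! ### §1 The one-sided-(c) package at a datum -/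

section Shapes

variable {K : Type} [Field K] [NumberField K] (W : WeierstrassCurve ℚ) (p : ℕ) [Fact p.Prime]
  (κ : ZpExtension K p) (𝔭 : HeightOneSpectrum (𝓞 K)) (γ : Field.absoluteGaloisGroup K)
  [Fact (κ.IsTopGenerator γ)] (ι : PadicAlgCl p ≃+* ℂ) {N : ℕ}
  (f : CuspForm (CongruenceSubgroup.Gamma0 N) 2)

/-- **ONE-SIDED CONGRUENCE DATA AT A DATUM, (c) AND `Σ`-IDENTITY ONE-SIDED (shape; asserts nothing).**
Exactly imc24c's `P2.OneSidedCongruenceDataTorsionAt W p κ 𝔭 γ ι f` except that the congruence input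
(c) is the INCLUSION `(L_m) ⊆ (L^Σ) + (p)^m` [Cas18 (4.1) + `ν_{g_m} ≡ ν_f`, in either reading of
Cas20 Thm. 2.11 at the `p`-new point] and the `Σ`-identity is the DIVISIBILITY `L·P_Σ ∣ L^Σ` [Cas18
(3.1), the half the descent uses]: an `R₀`-frame `(Ω_K ≠ 0, Ω_p ∈ R₀ˣ, L)` with
`IsBDPLFunction ι 𝔭 κ γ f Ω_K Ω_p L` [Cas18 Thm. 3.1]; a finite `Σ` with `X^Σ` `Λ`-TORSION [CTL];
`P_Σ ≠ 0`, `Ch(X^∅)·(P_Σ) ⊆ Ch(X^Σ)`; members `N_m` (`ModuleCat Λ`, finite) with `Λ`-isomorphisms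
`X^Σ/p^m ≅ N_m/p^m` [(b)+Lemma 2.1], printed inclusions `N_m torsion → Ch(N_m)·R₀⟦T⟧ ⊆ (L_m)` [(2.5)_m,
FW21 4.41 at `p ∥ N`, PREPRINT]. A predicate; NEVER a theorem in this cell.
[claim: Castella2018Erratum, status: under-review]
[cite: Castella2018Erratum, (a)–(c), Lemma 2.1, (2.5), proof of Thm. 1.1 (pp. 2–4) (shape only; nothing asserted)]
[cite: Castella2018, Def. 2.2, (3.1), Thm. 3.1, (4.1) (arXiv:1704.06608 pp. 5, 9, 11) (shape only; nothing asserted)] -/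
@[conjecture]
def P2.OneSidedCongruenceDataLeAt : Prop :=
  ∃ (ΩK : ℂ) (Ωp : (unrIntegers p)ˣ) (L : UnrSeries p) (S : Set (HeightOneSpectrum (𝓞 K)))
    (PS : IwasawaAlgebra p) (LS : UnrSeries p) (Nm : ℕ → ModuleCat.{0} (IwasawaAlgebra p))
    (Lm : ℕ → UnrSeries p),
    ΩK ≠ 0 ∧ IsBDPLFunction ι 𝔭 κ γ f ΩK ((Ωp : unrIntegers p) : ℂ_[p]) L ∧
    S.Finite ∧ Module.IsTorsion (IwasawaAlgebra p) (XAc (W.baseChange K) p κ 𝔭 S γ) ∧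
    PS ≠ 0 ∧ XAc.charIdeal (W.baseChange K) p κ 𝔭 ∅ γ * Ideal.span {PS} ≤
      XAc.charIdeal (W.baseChange K) p κ 𝔭 S γ ∧
    L * PowerSeries.map (toUnr p) PS ∣ LS ∧
    (∀ m : ℕ, Module.Finite (IwasawaAlgebra p) (Nm m)) ∧
    (∀ m : ℕ, 1 ≤ m → Nonempty
      ((XAc (W.baseChange K) p κ 𝔭 S γ ⧸
          ((Ideal.span {(PowerSeries.C (p : ℤ_[p]) : IwasawaAlgebra p)}) ^ m •
            (⊤ : Submodule (IwasawaAlgebra p) (XAc (W.baseChange K) p κ 𝔭 S γ)))) ≃ₗ[IwasawaAlgebra p]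
        ((Nm m) ⧸ ((Ideal.span {(PowerSeries.C (p : ℤ_[p]) : IwasawaAlgebra p)}) ^ m •
          (⊤ : Submodule (IwasawaAlgebra p) (Nm m)))))) ∧
    (∀ m : ℕ, 1 ≤ m → Module.IsTorsion (IwasawaAlgebra p) (Nm m) →
      (Module.charIdeal (IwasawaAlgebra p) (Nm m)).map (PowerSeries.map (toUnr p)) ≤ Ideal.span {Lm m}) ∧
    (∀ m : ℕ, 1 ≤ m →
      Ideal.span {Lm m} ≤
        Ideal.span {LS} ⊔ (Ideal.span {(PowerSeries.C ((p : ℕ) : unrIntegers p) : UnrSeries p)}) ^ m)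

variable {W p κ 𝔭 γ ι f}

/-- **imc24c's torsion-only package implies the one-sided-(c) package**, conjunct by conjunct
(`(a) + J = (b) + J ⟹ (a) ⊆ (b) + J`; `(L^Σ) = (L·P_Σ) ⟹ L·P_Σ ∣ L^Σ`): nothing is lost.
[cite: Castella2018Erratum, (c) (p. 4)] -/
theorem P2.oneSidedCongruenceDataLeAt_of_torsionAt
    (h : P2.OneSidedCongruenceDataTorsionAt W p κ 𝔭 γ ι f) :
    P2.OneSidedCongruenceDataLeAt W p κ 𝔭 γ ι f := by
  obtain ⟨ΩK, Ωp, L, S, PS, LS, Nm, Lm, hΩ, hL, hS, hT, hPS, hX, hLS, hfin, he, hF, hc⟩ := h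
  obtain ⟨hc', hLS'⟩ := AcSelmer.XAc.oneSided_inputs_of_eq p hc hLS
  exact ⟨ΩK, Ωp, L, S, PS, LS, Nm, Lm, hΩ, hL, hS, hT, hPS, hX, hLS', hfin, he, hF, hc'⟩

/-- **At a datum: one-sided-(c) data ⟹ an `R₀`-frame with `Ch_Λ(X_ac^∅(E[p^∞]))·R₀⟦T⟧ ⊆ (L)`**
(`AcSelmer.XAc.charIdeal_map_toUnr_le_span_of_oneSided_congruences_le`). CONDITIONAL on the data.
[cite: Castella2018Erratum, proof of Thm. 1.1 (p. 4), read one-sidedly] -/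
theorem P2.exists_unrFrame_charIdeal_map_le_of_oneSidedCongruenceDataLeAt [W.IsElliptic]
    (h : P2.OneSidedCongruenceDataLeAt W p κ 𝔭 γ ι f) :
    ∃ (ΩK : ℂ) (Ωp : (unrIntegers p)ˣ) (L : UnrSeries p), ΩK ≠ 0 ∧
      IsBDPLFunction ι 𝔭 κ γ f ΩK ((Ωp : unrIntegers p) : ℂ_[p]) L ∧
      (XAc.charIdeal (W.baseChange K) p κ 𝔭 ∅ γ).map (PowerSeries.map (toUnr p)) ≤
        Ideal.span {L} := by
  obtain ⟨ΩK, Ωp, L, S, PS, LS, Nm, Lm, hΩ, hL, hS, hT, hPS, hX, hLS, hfin, he, hF, hc⟩ := h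
  haveI : ∀ m, Module.Finite (IwasawaAlgebra p) (Nm m) := hfin
  exact ⟨ΩK, Ωp, L, hΩ, hL,
    AcSelmer.XAc.charIdeal_map_toUnr_le_span_of_oneSided_congruences_le (W.baseChange K) p κ 𝔭 γ hS
      hT (fun m ↦ Nm m) LS Lm (fun m hm ↦ (he m hm).some) hF hc hPS hX hLS⟩

/-- **At a datum: one-sided-(c) data ⟹ the ♭-frame conjunct of the crux** (+ imc24c's last mile
`P2.exists_intCoreFrame_of_unrFrame_of_charIdeal_map_le`). CONDITIONAL on the data.
[cite: Castella2018Erratum, (2.4) and proof of Thm. 1.1 (p. 4)] -/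
theorem P2.exists_intCoreFrame_of_oneSidedCongruenceDataLeAt [W.IsElliptic]
    (h : P2.OneSidedCongruenceDataLeAt W p κ 𝔭 γ ι f) :
    ∃ (ΩK : ℂ) (Ωp : ℂ_[p]) (Q : PowerSeries 𝓞_ℂ_[p]), ΩK ≠ 0 ∧ ‖Ωp‖ = 1 ∧
      R1.IsBDPLFunctionInt p ι 𝔭 κ γ f ΩK Ωp Q ∧
      (XAc.charIdeal (W.baseChange K) p κ 𝔭 ∅ γ).map (PowerSeries.map (R1.toCpInt p)) ≤
        Ideal.span {Q} := by
  obtain ⟨ΩK, Ωp, L, hΩ, hL, hdiv⟩ :=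
    P2.exists_unrFrame_charIdeal_map_le_of_oneSidedCongruenceDataLeAt h
  exact P2.exists_intCoreFrame_of_unrFrame_of_charIdeal_map_le W p κ 𝔭 γ ι f hΩ hL hdiv

end Shapes

/-! ### §2 At every erratum datum: the glue to the crux and to both registered stubs -/

section OnTree

variable (W : WeierstrassCurve ℚ) [W.IsElliptic] [W.IsGloballyMinimal] (p : ℕ) [Fact p.Prime]

/-- **ONE-SIDED-(c) CONGRUENCE DATA AT EVERY ERRATUM DATUM of `(W, p)` (shape; asserts nothing)** —
the binders of `P2.IMCDivIntCoreFrameAtErratumData W p` VERBATIM, and at each datum the package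
`P2.OneSidedCongruenceDataLeAt W p κ 𝔭_{ι'} γ ι' Dt.f`. NO sign condition on `a_p`; NO Lemma 2.2; NO
`p`-new identification beyond `L^Σ ∣ ν_f(L^Σ(𝐟))`. A predicate on `(W, p)`; NEVER a theorem in this cell.
[claim: Castella2018Erratum, status: under-review]
[cite: Castella2018Erratum, Thm. 1.1 (i)–(iv) and its proof (pp. 1, 4) (shape only; nothing asserted)] -/
@[conjecture]
def P2.OneSidedCongruenceDataLeAtErratumData : Prop :=
  ∀ [NeZero (W.conductorNorm ℤ)] (q : ℕ) [Fact q.Prime] (K : Type) [Field K] [NumberField K]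
    (Dt : ModularParametrizationData W (W.conductorNorm ℤ))
    (H : HeegnerDatum (W.conductorNorm ℤ) (NumberField.discr K)) (w₀ : InfinitePlace K)
    (P : (W.baseChange K).toAffine.Point), ErratumHypotheses W p → W.analyticRank = 1 →
    q ≠ p → Mult W q → ¬ W.HasSplitMultiplicativeReductionAtPrime q →
    ¬ p ∣ padicValInt q W.minimalDiscriminantInt → IsErratumField W K q →
    Cas20Standing K p (W.conductorNorm ℤ / p) →
    WeierstrassCurve.Affine.Point.map w₀.embedding.toRatAlgHom P = heegnerPointComplex Dt H →
    ¬ (p : ℤ) ∣ Dt.c → ¬ IsOfFinAddOrder P →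
    ∀ (κ : ZpExtension K p), κ.IsAnticyclotomic →
      ∀ (γ : Field.absoluteGaloisGroup K) [Fact (κ.IsTopGenerator γ)] (ι' : PadicAlgCl p ≃+* ℂ)
        (e : K →+* ℚ_[p]),
        (∀ k : 𝓞 K, k ∈ (primeOfEmbeddingDatum p ι' w₀.embedding).asIdeal ↔ ‖e (k : K)‖ < 1) →
        P2.OneSidedCongruenceDataLeAt W p κ (primeOfEmbeddingDatum p ι' w₀.embedding) γ ι' Dt.f

variable {W p}

omit [W.IsElliptic] in
/-- imc24c's torsion-only data at every erratum datum ⟹ the one-sided-(c) data there.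
[cite: Castella2018Erratum, (c) (p. 4)] -/
theorem P2.oneSidedCongruenceDataLeAtErratumData_of_torsion
    (h : P2.OneSidedCongruenceDataTorsionAtErratumData W p) :
    P2.OneSidedCongruenceDataLeAtErratumData W p := by
  intro _ q _ K _ _ Dt H w₀ P hE hr hqp hmq hns hvq hK hCas hP hc hinf κ hκ γ _ ι' e he
  exact P2.oneSidedCongruenceDataLeAt_of_torsionAt
    (h q K Dt H w₀ P hE hr hqp hmq hns hvq hK hCas hP hc hinf κ hκ γ ι' e he)

/-- **THE GLUE, ONE-SIDED (c) (every pair, both signs of `a_p`, no Lemma 2.2): one-sided-(c) congruence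
data at every erratum datum ⟹ `P2.IMCDivIntCoreFrameAtErratumData W p`**, the shape of crux 19270.
CONDITIONAL on the data (PREPRINT-derived at `p ∥ N`); closes nothing by itself.
[cite: Castella2018Erratum, proof of Thm. 1.1 (p. 4), read one-sidedly] [cite: Skinner2016PacificMC, §3.1 (p. 192)] -/
theorem P2.imcDivIntCoreFrameAtErratumData_of_oneSidedCongruenceDataLe
    (h : P2.OneSidedCongruenceDataLeAtErratumData W p) :
    P2.IMCDivIntCoreFrameAtErratumData W p := by
  intro _ q _ K _ _ Dt H w₀ P hE hr hqp hmq hns hvq hK hCas hP hc hinf κ hκ γ _ ι' e he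
  exact P2.exists_intCoreFrame_of_oneSidedCongruenceDataLeAt
    (h q K Dt H w₀ P hE hr hqp hmq hns hvq hK hCas hP hc hinf κ hκ γ ι' e he)

/-- **Registered stub S1 `stub_imcDivErratum_nonsplitAtP` of crux 19270 — signature VERBATIM as
conclusion — from the one-sided-(c) data on every pair** (sign hypothesis unused). CONDITIONAL on the data.
[cite: Castella2018Erratum, Thm. 1.1 and its proof (pp. 1, 4)] -/
theorem P2.stub_imcDivErratum_nonsplitAtP_of_oneSidedCongruenceDataLe
    (h : ∀ (W : WeierstrassCurve ℚ) [W.IsElliptic] [W.IsGloballyMinimal] (p : ℕ) [Fact p.Prime],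
      P2.OneSidedCongruenceDataLeAtErratumData W p) :
    ∀ (W : WeierstrassCurve ℚ) [W.IsElliptic] [W.IsGloballyMinimal] (p : ℕ) [Fact p.Prime],
      ¬ W.HasSplitMultiplicativeReductionAtPrime p →
        Summit.BirchSwinnertonDyer.Rank1Residual.X11b.P2.IMCDivIntCoreFrameAtErratumData W p :=
  fun W _ _ p _ _ ↦ P2.imcDivIntCoreFrameAtErratumData_of_oneSidedCongruenceDataLe (h W p)

/-- **Registered stub S2 `stub_imcDivErratum_splitAtP` of crux 19270 — signature VERBATIM as conclusion —
from the SAME one-sided-(c) data** (sign hypothesis unused; at `a_p = +1` this is the package whose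
(c) print delivers without the `p`-new identification, companion `…PNewSeam`). CONDITIONAL on the data.
[cite: Castella2018Erratum, Thm. 1.1 and its proof (pp. 1, 4)] [cite: Castella2020JIMJ, Thm. 2.11] -/
theorem P2.stub_imcDivErratum_splitAtP_of_oneSidedCongruenceDataLe
    (h : ∀ (W : WeierstrassCurve ℚ) [W.IsElliptic] [W.IsGloballyMinimal] (p : ℕ) [Fact p.Prime],
      P2.OneSidedCongruenceDataLeAtErratumData W p) :
    ∀ (W : WeierstrassCurve ℚ) [W.IsElliptic] [W.IsGloballyMinimal] (p : ℕ) [Fact p.Prime],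
      W.HasSplitMultiplicativeReductionAtPrime p →
        Summit.BirchSwinnertonDyer.Rank1Residual.X11b.P2.IMCDivIntCoreFrameAtErratumData W p :=
  fun W _ _ p _ _ ↦ P2.imcDivIntCoreFrameAtErratumData_of_oneSidedCongruenceDataLe (h W p)

end OnTree

end Summit.BirchSwinnertonDyer.Rank1Residual.X11b

end
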